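import Literature.AlgebraicGeometry.Motives.MorphismsToProjectiveSpace
import HarnessLib

/-!
# Morphisms to projective space from generating sections: the isomorphism criterion

Sequel of `Motives/MorphismsToProjectiveSpace` (Hartshorne II Thm. 7.1 / Prop. 7.2 for
generating-sections data `GeneratingSections`). Hartshorne's proof of II Prop. 7.2 identifies the
restriction of `φ : X → ℙ(ι)_k` over the standard chart `D₊(xᵢ)` with
`Spec (k[x_j/x_i : j] → Γ(Xᵢ, 𝒪_{Xᵢ}))` when `Xᵢ` is affine; hence `φ` is a closed immersion when
these ring maps are surjective (II 7.2, the tree's `isClosedImmersion_toProj`) and — the variant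
recorded here — **an isomorphism when they are bijective** (isomorphisms are Zariski-local on the
target). This is the form in which "`E ≅ ℙ(𝓘/𝓘²)` is Zariski-locally `U × ℙʳ`" (Hartshorne II
Thm. 8.24 (b), Liu Thm. 8.1.19 (b)) is checked chart by chart.

* `GeneratingSections.toProj_restrict_eq` — over `D₊(xᵢ)`, `toProj` is `Spec` of `sectionsRingHom`
  up to the identifications `toProj⁻¹ D₊(xᵢ) = U i ≅ Spec Γ(Y, U i)`, `D₊(xᵢ) ≅ Spec (k[x]_{(xᵢ)})₀`;
* `GeneratingSections.isIso_toProj_restrict`, `GeneratingSections.isIso_toProj` — **the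
  isomorphism criterion**.

## References

* [Hartshorne1977] R. Hartshorne, Algebraic Geometry, GTM 52 (1977), II Thm. 7.1, II Prop. 7.2 (proof).
* [StacksProject] The Stacks Project, Tag 01NE.
-/

universe u

open CategoryTheory AlgebraicGeometry Limits HomogeneousLocalization TopologicalSpace Opposite
open MvPolynomial (X C)
open Literature.AlgebraicGeometry.Motives.Segre

attribute [local instance] MvPolynomial.gradedAlgebra

noncomputable section

namespace Literature.AlgebraicGeometry.Motives

namespace GeneratingSections

variable {ι : Type} {Y : Scheme.{u}} (D : GeneratingSections ι Y)
variable {k : Type u} [CommRing k] (f : Y ⟶ Spec (.of k)) (i : ι)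

/-- Over the chart `D₊(xᵢ)`, `toProj` is — up to the isomorphisms `toProj⁻¹ D₊(xᵢ) = U i ≅ Spec Γ(Y, U i)`
and `D₊(xᵢ) ≅ Spec (k[x]_{(xᵢ)})₀` — the morphism `Spec Γ(Y, U i) → Spec (k[x]_{(xᵢ)})₀` induced by
the chart ring map `x_j/x_i ↦ s_j/s_i` (Hartshorne II Prop. 7.2, proof). [cite: Hartshorne1977, II Prop. 7.2] -/
theorem toProj_restrict_eq (hU : IsAffineOpen (D.U i)) :
    D.toProj f ∣_ Proj.basicOpen (grading ι k) (X i) =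
      (Y.isoOfEq (D.toProj_preimage_basicOpen f i)).hom ≫
        (hU.isoSpec.hom ≫ Spec.map (CommRingCat.ofHom (D.sectionsRingHom f i))) ≫
        (Proj.basicOpenIsoSpec (grading ι k) (X i) (X_mem k i) zero_lt_one).inv := by
  rw [← cancel_mono (Proj.basicOpen (grading ι k) (X i)).ι]
  simp only [Category.assoc, morphismRestrict_ι, Proj.basicOpenIsoSpec_inv_ι,
    IsAffineOpen.isoSpec_hom]
  rw [← Scheme.isoOfEq_hom_ι Y (D.toProj_preimage_basicOpen f i), Category.assoc, ι_toProj,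
    chart_eq]

/-- Over `D₊(xᵢ)`, `toProj` restricts to `U i → D₊(xᵢ)`, which for `U i` affine and
`k[x_j/x_i : j] → Γ(Y, U i)` bijective is an isomorphism (Hartshorne II Prop. 7.2, proof: the
restriction is `Spec` of that ring map). [cite: Hartshorne1977, II Prop. 7.2] -/
theorem isIso_toProj_restrict (hU : IsAffineOpen (D.U i))
    (hs : Function.Bijective (D.sectionsRingHom f i)) :
    IsIso (D.toProj f ∣_ Proj.basicOpen (grading ι k) (X i)) := by
  have hΦ : IsIso (CommRingCat.ofHom (D.sectionsRingHom f i)) :=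
    (RingEquiv.ofBijective _ hs).toCommRingCatIso.isIso_hom
  haveI : IsIso (Spec.map (CommRingCat.ofHom (D.sectionsRingHom f i))) := inferInstance
  rw [D.toProj_restrict_eq f i hU]
  infer_instance

/-- **Isomorphism criterion for the morphism defined by generating sections.** If every
`U i = Y_{sᵢ}` is affine and every chart ring map `k[x_j/x_i : j] → Γ(Y, U i)`, `x_j/x_i ↦ s_j/s_i`, is
bijective, then `Y → ℙ(ι)_k` is an isomorphism (isomorphisms are Zariski-local on the target and the
`D₊(xᵢ)` cover `ℙ(ι)`; Hartshorne II Prop. 7.2, proof). [cite: Hartshorne1977, II Prop. 7.2] -/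
theorem isIso_toProj (hU : ∀ i, IsAffineOpen (D.U i))
    (hs : ∀ i, Function.Bijective (D.sectionsRingHom f i)) : IsIso (D.toProj f) := by
  have h : MorphismProperty.isomorphisms Scheme (D.toProj f) := by
    refine IsZariskiLocalAtTarget.of_iSup_eq_top
      (fun i : ι ↦ Proj.basicOpen (grading ι k) (X i)) ?_ fun i ↦ ?_
    · exact Proj.iSup_basicOpen_eq_top (grading ι k) (fun i : ι ↦ (X i : MvPolynomial ι k))
        (irrelevant_le_span_X ι k)
    · exact D.isIso_toProj_restrict f i (hU i) (hs i)
  exact h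

end GeneratingSections

end Literature.AlgebraicGeometry.Motives

end
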